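import Mathlib.CategoryTheory.Sites.EpiMono
import Mathlib.CategoryTheory.Sites.LocallySurjective
import Mathlib.Algebra.Category.Grp.Zero
import Literature.AlgebraicGeometry.Motives.EtalePushforward
import HarnessLib

/-!
# Exactness of `π_*` from étale-local decompositions ("property (B)", Stacks 04DO–04DP)

`Literature/AlgebraicGeometry/Motives/EtaleCohomologicalDimensionAlgebraic.lean` vendors the
exactness of the direct image `π_*` (`etalePushforward`, `EtalePushforward.lean`) for
`π : Spec K → Spec k`, `K/k` algebraic (Stacks Tag 04C2 (4), Milne II Cor. 3.6), and derives from
it Shapiro's lemma and the algebraic case of Tate's theorem. The Stacks Project proves 04C2 by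
splitting it into a sheaf-theoretic half and a scheme-theoretic half (Section "Push and pull",
property (B)):

* 04DO: "Let `f : X → Y` be a morphism of schemes. Assume (B) holds. Then the functor
  `f_{small,*} : Sh(X_et) → Sh(Y_et)` transforms surjections into surjections", where (B) is
  "For every `V → Y` étale, and every étale covering `{U_i → X ×_Y V}` there exists an étale
  covering `{V_j → V}` such that for each `j` we have `X ×_Y V_j = ∐ W_{ij}` where
  `W_{ij} → X ×_Y V` factors through `U_i → X ×_Y V` for some `i`";
* 04DP: the pointwise form of (B) with étale neighbourhoods `(V', v') → (V, v)` suffices;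
* 04DQ / 04DR: finite / integral morphisms satisfy (B).

This file **proves the sheaf-theoretic half** (04DP ⇒ 04DO ⇒ right exactness) on Mathlib's
small étale sites, so that only the scheme-theoretic half remains to be supplied for
`Spec K → Spec k`:

* `IsClopenDecomposition W c` — "`V = ∐ W_m`" in `X_et`: a family of open immersions with
  pairwise disjoint images covering `V`; sections of a sheaf over the `W_m` **glue uniquely**
  (`IsClopenDecomposition.exists_glue`, `IsClopenDecomposition.ext`);
* `HasEtaleLocalDecompositions f` — **property (B) in the pointwise form 04DP** (definition);
* `isLocallySurjective_etalePushforward_map` — **04DO, proved**: under (B), `π_*` preserves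
  locally surjective morphisms of abelian sheaves, hence epimorphisms
  (`epi_etalePushforward_map`, `preservesEpimorphisms_etalePushforward`).

## References

* The Stacks Project, Tags 04DO, 04DP (property (B) ⇒ `f_{small,*}` preserves surjections),
  04DQ, 04DR, 04C2. [StacksProject]
* J. S. Milne, *Étale cohomology*, II §3, Cor. 3.6. [Milne2025]

## Design notes

* (B) is stated with ordinary points `u ∈ U` and étale neighbourhoods `a : U' → U`,
  `u ∈ range a` (04DP), the decomposition being indexed by a type in `Type u`; covering sieves of
  the small étale site are exactly the sieves containing, for every point, an arrow whose image
  contains it (`mem_smallEtaleTopology_iff_forall_exists`).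
* Epimorphisms of `Ab`-valued étale sheaves are the locally surjective morphisms (Mathlib
  `Sheaf.isLocallySurjective_iff_epi'`); no stalks are used.
* What is NOT here: that `Spec K → Spec k` (`K/k` algebraic), or more generally an integral
  morphism, has property (B) (04DR) — field theory, the next layer.
-/

universe u

open CategoryTheory CategoryTheory.Limits AlgebraicGeometry Opposite

namespace Literature.AlgebraicGeometry.Motives

variable {X Y : Scheme.{u}} (f : X ⟶ Y)

/-! ### Covering sieves of the small étale site, pointwise -/

set_option backward.isDefEq.respectTransparency false in
/-- A sieve on `U` in the small étale site is covering iff every point of `U` is in the image of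
one of its arrows (Mathlib `Scheme.mem_toGrothendieck_smallPretopology`). [folklore] -/
theorem mem_smallEtaleTopology_iff_forall_exists (U : Y.Etale) (R : Sieve U) :
    R ∈ Y.smallEtaleTopology U ↔
      ∀ u : ↥U.left, ∃ (V : Y.Etale) (g : V ⟶ U) (v : ↥V.left), R g ∧ g.left v = u := by
  have h1 : R ∈ Y.smallEtaleTopology U ↔
      R ∈ (Y.smallPretopology (Q := @Etale) @Etale).toGrothendieck U := by
    change R ∈ Y.smallGrothendieckTopology (P := @Etale) U ↔ _
    rw [Scheme.smallGrothendieckTopology_eq_toGrothendieck_smallPretopology _ le_rfl]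
  exact h1.trans ((Scheme.mem_toGrothendieck_smallPretopology U R).trans (forall_congr' fun u =>
    ⟨fun ⟨V, g, v, h, _, e⟩ => ⟨V, g, v, h, e⟩,
      fun ⟨V, g, v, h, e⟩ => ⟨V, g, v, h, inferInstance, e⟩⟩))

/-- The empty sieve covers an object of the small étale site with empty underlying space
(private copy of the tree's `bot_mem_smallEtaleTopology`, `ConstantEtaleSheaf.lean`, to keep the
import closure small). [folklore] -/
private theorem bot_mem_smallEtaleTopology' (Z : X.Etale) [IsEmpty ↥Z.left] :
    (⊥ : Sieve Z) ∈ X.smallEtaleTopology Z := by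
  obtain ⟨I, W, g, h⟩ := (⊥ : Sieve Z).exists_eq_ofArrows
  rw [h, Scheme.ofArrows_mem_smallEtaleTopology_iff]
  exact Set.eq_univ_of_forall fun z => isEmptyElim z

/-- Sections of an abelian étale sheaf over an object with empty underlying space are trivial
(private copy of the tree's `subsingleton_sections_of_isEmpty`,
`EtaleArtinSchreierExactProofs.lean`). [folklore] -/
private theorem subsingleton_sections_of_isEmpty' (F : Sheaf X.smallEtaleTopology Ab.{u})
    (Z : X.Etale) [IsEmpty ↥Z.left] : Subsingleton (F.obj.obj (op Z)) :=
  AddCommGrpCat.subsingleton_of_isZero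
    (F.isTerminalOfBotCover Z (bot_mem_smallEtaleTopology' Z)).isZero

/-! ### Clopen decompositions `V = ∐ W_m` in the small étale site -/

/-- A family `c m : W m ⟶ V` in `X_et` is a **clopen decomposition** of `V` ("`V = ∐_m W_m`",
as in property (B) of Stacks 04DO) if the `c m` are open immersions with pairwise disjoint
images jointly covering `V`. [cite: StacksProject, Tag 04DO (property (B))] -/
def IsClopenDecomposition {V : X.Etale} {ι : Type*} (W : ι → X.Etale) (c : ∀ m, W m ⟶ V) :
    Prop :=
  (∀ m, IsOpenImmersion (c m).left) ∧ (⋃ m, Set.range (c m).left) = Set.univ ∧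
    Pairwise fun m m' => Disjoint (Set.range (c m).left) (Set.range (c m').left)

namespace IsClopenDecomposition

variable {V : X.Etale} {ι : Type*} {W : ι → X.Etale} {c : ∀ m, W m ⟶ V}

/-- A clopen decomposition is an étale covering. [folklore] -/
theorem ofArrows_mem (h : IsClopenDecomposition W c) :
    Sieve.ofArrows W c ∈ X.smallEtaleTopology V :=
  (Scheme.ofArrows_mem_smallEtaleTopology_iff c).2 h.2.1

/-- The pieces of a clopen decomposition are monomorphisms of the small étale site. [folklore] -/
theorem mono (h : IsClopenDecomposition W c) (m : ι) : Mono (c m) :=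
  haveI := h.1 m
  (Scheme.Etale.forget X ⋙ Over.forget X).mono_of_mono_map (show Mono (c m).left from inferInstance)

set_option backward.isDefEq.respectTransparency false in
/-- Two pieces of a clopen decomposition receiving compatible maps from an object with a point
coincide. [folklore] -/
theorem eq_of_comp_eq (h : IsClopenDecomposition W c) {Z : X.Etale} {m m' : ι} (g : Z ⟶ W m)
    (g' : Z ⟶ W m') (hgg : g ≫ c m = g' ≫ c m') (z : ↥Z.left) : m = m' := by
  by_contra hne
  have e : g.left ≫ (c m).left = g'.left ≫ (c m').left := by
    rw [← MorphismProperty.Comma.comp_left, ← MorphismProperty.Comma.comp_left, hgg]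
  have e' : (c m).left (g.left z) = (c m').left (g'.left z) := by
    simpa only [Scheme.Hom.comp_apply] using congrArg (fun φ => φ z) e
  exact Set.disjoint_iff.1 (h.2.2 hne) ⟨⟨_, rfl⟩, ⟨_, e'.symm⟩⟩

/-- Any family of sections over the pieces of a clopen decomposition is compatible. [folklore] -/
theorem arrows_compatible (h : IsClopenDecomposition W c) (F : Sheaf X.smallEtaleTopology Ab.{u})
    (t : ∀ m, F.obj.obj (op (W m))) :
    Presieve.Arrows.Compatible (F.obj ⋙ forget Ab.{u}) c t := by
  intro i j Z gi gj hgij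
  by_cases hZ : IsEmpty ↥Z.left
  · haveI := subsingleton_sections_of_isEmpty' F Z
    exact Subsingleton.elim (α := F.obj.obj (op Z)) _ _
  · obtain ⟨z⟩ := not_isEmpty_iff.1 hZ
    obtain rfl := h.eq_of_comp_eq gi gj hgij z
    haveI := h.mono i
    obtain rfl : gi = gj := (cancel_mono (c i)).1 hgij
    rfl

/-- **Sections glue along a clopen decomposition**: for every abelian étale sheaf `F` and
sections `t m ∈ F(W m)` there is `s ∈ F(V)` restricting to the `t m` (no compatibility is
needed: the pieces are disjoint). [folklore] -/
theorem exists_glue (h : IsClopenDecomposition W c) (F : Sheaf X.smallEtaleTopology Ab.{u})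
    (t : ∀ m, F.obj.obj (op (W m))) :
    ∃ s : F.obj.obj (op V), ∀ m, F.obj.map (c m).op s = t m := by
  have hs : Presieve.IsSheafFor (F.obj ⋙ forget Ab.{u}) (Presieve.ofArrows W c) := by
    rw [Presieve.isSheafFor_iff_generate]
    exact (isSheaf_iff_isSheaf_of_type _ _).1
      ((sheafCompose X.smallEtaleTopology (forget Ab.{u})).obj F).property _ h.ofArrows_mem
  rw [Presieve.isSheafFor_arrows_iff] at hs
  obtain ⟨s, hs1, -⟩ := hs t (h.arrows_compatible F t)
  exact ⟨s, hs1⟩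

/-- Sections over `V` agreeing on the pieces of a clopen decomposition (indeed of any étale
covering) are equal. [folklore] -/
theorem ext (h : IsClopenDecomposition W c) (F : Sheaf X.smallEtaleTopology Ab.{u})
    {s s' : F.obj.obj (op V)} (hss : ∀ m, F.obj.map (c m).op s = F.obj.map (c m).op s') :
    s = s' := by
  refine F.isSeparated _ _ h.ofArrows_mem s s' ?_
  rintro Z g ⟨Z', a, b, ⟨m⟩, rfl⟩
  simp only [op_comp, Functor.map_comp, ConcreteCategory.comp_apply, hss m]

end IsClopenDecomposition

/-! ### Property (B) (Stacks 04DO, pointwise form 04DP) -/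

/-- **Property (B) of a morphism `f : X ⟶ Y`, pointwise form** (Stacks 04DP): for every
`U → Y` étale, every étale covering sieve `S` of `U ×_Y X` and every point `u ∈ U` there are
an étale neighbourhood `a : U' → U` of `u` (`u ∈ range a`) and a clopen decomposition
`U' ×_Y X = ∐_m W_m` in `X_et` such that each `W_m → U' ×_Y X → U ×_Y X` belongs to `S`
("a disjoint union decomposition `X ×_Y V' = ∐ W'_i`, and morphisms `W'_i → U_i` over
`X ×_Y V`"). Stacks 04DQ / 04DR: finite and integral morphisms have this property.
[cite: StacksProject, Tag 04DP] -/
def HasEtaleLocalDecompositions (f : X ⟶ Y) : Prop :=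
  ∀ (U : Y.Etale) (S : Sieve ((etaleBaseChange f).obj U)),
    S ∈ X.smallEtaleTopology ((etaleBaseChange f).obj U) →
    ∀ u : ↥U.left, ∃ (U' : Y.Etale) (a : U' ⟶ U), u ∈ Set.range a.left ∧
      ∃ (ι : Type u) (W : ι → X.Etale) (c : ∀ m, W m ⟶ (etaleBaseChange f).obj U'),
        IsClopenDecomposition W c ∧ ∀ m, S (c m ≫ (etaleBaseChange f).map a)

/-- **Stacks 04DO: under property (B), `π_*` preserves locally surjective morphisms** of abelian
étale sheaves. Given `s ∈ (π_* F')(U) = F'(U ×_Y X)`, apply (B) to the image sieve of `s`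
(a covering of `U ×_Y X`, `φ` being locally surjective): over an étale neighbourhood `U'` of a
given point, `U' ×_Y X = ∐ W_m` with `s|_{W_m}` in the image of `φ`; the chosen preimages glue
to `t ∈ F(U' ×_Y X)` (`IsClopenDecomposition.exists_glue`) with `φ(t) = s|_{U' ×_Y X}`
(`IsClopenDecomposition.ext`), so the image sieve of `s` for `π_* φ` is covering.
[cite: StacksProject, Tag 04DO] -/
theorem isLocallySurjective_etalePushforward_map (hB : HasEtaleLocalDecompositions f)
    {F F' : Sheaf X.smallEtaleTopology Ab.{u}} (φ : F ⟶ F') [Sheaf.IsLocallySurjective φ] :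
    Sheaf.IsLocallySurjective ((etalePushforward f Ab.{u}).map φ) where
  imageSieve_mem {U} s := by
    rw [mem_smallEtaleTopology_iff_forall_exists]
    intro u
    obtain ⟨U', a, ⟨u', hu'⟩, ι, W, c, hc, hS⟩ :=
      hB U (Presheaf.imageSieve φ.hom s) (Presheaf.imageSieve_mem _ φ.hom s) u
    refine ⟨U', a, u', ?_, hu'⟩
    choose t ht using hS
    obtain ⟨t', ht'⟩ := hc.exists_glue F t
    refine ⟨t', hc.ext F' fun m => ?_⟩
    change F'.obj.map (c m).op (φ.hom.app _ t') =
      F'.obj.map (c m).op (F'.obj.map ((etaleBaseChange f).map a).op s)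
    rw [← ConcreteCategory.comp_apply, ← φ.hom.naturality, ConcreteCategory.comp_apply, ht' m, ht m,
      ← ConcreteCategory.comp_apply, ← F'.obj.map_comp, ← op_comp]

/-- **Under property (B), `π_*` preserves epimorphisms** of abelian étale sheaves
(epimorphisms = locally surjective morphisms, Mathlib `Sheaf.isLocallySurjective_iff_epi'`).
[cite: StacksProject, Tag 04DO] -/
theorem epi_etalePushforward_map (hB : HasEtaleLocalDecompositions f)
    {F F' : Sheaf X.smallEtaleTopology Ab.{u}} (φ : F ⟶ F') [Epi φ] :
    Epi ((etalePushforward f Ab.{u}).map φ) := by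
  haveI : Sheaf.IsLocallySurjective φ :=
    (Sheaf.isLocallySurjective_iff_epi' (A := Ab.{u}) (φ := φ)).2 inferInstance
  haveI := isLocallySurjective_etalePushforward_map f hB φ
  infer_instance

/-- **Under property (B), `π_*` preserves epimorphisms** (as a `Functor.PreservesEpimorphisms`
instance-statement); with the proved left exactness this is the exactness of `π_*`
(`preservesFiniteColimits_etalePushforward_of_preservesEpimorphisms` in
`EtaleCohomologicalDimensionAlgebraic.lean`). [cite: StacksProject, Tags 04DO and 04C2] -/
theorem preservesEpimorphisms_etalePushforward (hB : HasEtaleLocalDecompositions f) :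
    (etalePushforward f Ab.{u}).PreservesEpimorphisms where
  preserves φ _ := epi_etalePushforward_map f hB φ

end Literature.AlgebraicGeometry.Motives
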